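import Summits.Ventures.PercRepro.Night2NoLoadsFair
import Summits.Ventures.PercRepro.Night2TopLine
import Summits.Ventures.PercRepro.Night2TwoOneResiduesC
import Summits.Ventures.PercRepro.Night2TwoOneSmall
import Summits.Ventures.PercRepro.Night2NonFatTen

/-!
# PercRepro — **THE `(7, 5)` SHADOW ROW MODULO THE RESIDUE `(2, 0)` AND THE NEAR-FAT CLAUSE OF `(2, 1)`** (night-2, gen 39)

Every `(2, 1)` cell is closed except the NEAR-FAT one: no fat closure, a thin member missing EXACTLY three points, and
`11 ≤ |G| ≤ 16` — `localShadowHall_two_one_of_seventeen` (`|G| ≥ 17`), gen 37's `localShadowHall_two_one_of_card_eq_ten`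
(`|G| = 10`), gen 28's `localShadowHall_of_small` (`|G| ≤ 9`), gens 28 / 36 (fat closures), and `localShadowHall_two_one_of_four_thin`
(every thin member missing `≥ 4` points: no loads).  **`shadowHall_seven_five_of_residuesZ6`**: the row of record, the `(2, 1)` clause
now reading «a thin member missing exactly three points, no fat closure, `11 ≤ |G| ≤ 16`».  Paper: proofs/NIGHT-2-g39.md §8.
-/

namespace PercRepro.Shadow

open Finset PerFlat ThmH

variable {α : Type*} [DecidableEq α] {M : Matroid α} [M.Finite] {G : Finset α}

/-- **h21's cell `(2, 1)` outside the near-fat clause**: at most one fat closure, and (no thin member missing exactly three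
points, or `|G| ≥ 17`, or `|G| ≤ 10`) ⇒ the local Hall inequality. -/
theorem localShadowHall_two_one_of_not_near_fat (hG : G ∈ flatsQ M (5 + 1)) (hd : (gr M \ G).card = 2)
    (hk : kColoops M G = 1) (hs : ∀ e ∈ gr M, ∀ f ∈ gr M, e ≠ f → rkN M {e, f} = 2)
    (hl : ∀ e ∈ gr M, M.Indep {e}) (hfat1 : (fatClosures M 5 G 2).card ≤ 1)
    (h : (∀ B ∈ thinMembers M 5 G, (G \ clF M B).card ≠ 3) ∨ 17 ≤ G.card ∨ G.card ≤ 10) :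
    LocalShadowHall M 5 G := by
  rcases Nat.lt_or_ge (fatClosures M 5 G 2).card 1 with h0 | h1
  · have hnf : fatClosures M 5 G 2 = ∅ := Finset.card_eq_zero.1 (by omega)
    rcases h with hno | h17 | h10
    · apply localShadowHall_two_one_of_four_thin hG hd hk hs hl
      intro B hB
      have h3 := three_le_card_sdiff_of_nonfat hnf hB
      have := hno B hB
      omega
    · exact localShadowHall_two_one_of_seventeen hG hd hk hs hl h17
    · rcases Nat.lt_or_ge G.card 10 with h9 | h10'
      · apply localShadowHall_of_small hG hd hk
        have hk1 : (coloops M G).card = 1 := by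
          rw [← kColoops_eq_card_coloops]
          exact hk
        have hsub : coloops M G ⊆ G := by
          unfold coloops
          exact Finset.filter_subset _ _
        rw [Finset.card_sdiff_of_subset hsub, hk1]
        omega
      · exact localShadowHall_two_one_of_card_eq_ten hG hd hk hs hl (by omega)
  · obtain ⟨B₀, hB₀, hm₀⟩ := exists_fat_member_of_card_eq_one hG hd (by omega)
    exact localShadowHall_fat hG hd hk hs hl hfat1 hB₀ hm₀

section SevenFiveZ6

variable {α' : Type} [DecidableEq α']

open scoped Classical in
/-- **THE `(7, 5)` SHADOW ROW FOR EVERY FINITE MATROID MODULO THE RESIDUE `(2, 0)` AND THE NEAR-FAT CLAUSE OF `(2, 1)`**: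
the `(2, 1)` clause now reads «a thin member missing exactly three points, no fat closure, `11 ≤ |G| ≤ 16`». -/
theorem shadowHall_seven_five_of_residuesZ6
    (h20 : ∀ (N : Matroid α') [N.Finite] (G : Finset α'), CellHyp N G →
      (gr N \ G).card = 2 → kColoops N G = 0 → FatMember N G 6 3 →
      (FatBasis N G 6 2 ∨ FatMember N G 6 2) →
      (2 ≤ (fatClosures N 5 G 2).card ∨
        ∃ B ∈ thinMembers N 5 G, 2 < (G \ clF N B).card ∧ (G \ clF N B).card < 5) →
      LocalShadowHall N 5 G)
    (h21 : ∀ (N : Matroid α') [N.Finite] (G : Finset α'), CellHyp N G →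
      (gr N \ G).card = 2 → kColoops N G = 1 → FatMember N G 5 4 →
      (FatBasis N G 5 3 ∨ FatMember N G 5 3) →
      (∃ B ∈ thinMembers N 5 G, (G \ clF N B).card = 3) → fatClosures N 5 G 2 = ∅ →
      11 ≤ G.card → G.card ≤ 16 → LocalShadowHall N 5 G)
    (M : Matroid α') [M.Finite] : ShadowHall M 7 5 (phiK 7 5) := by
  apply shadowHall_seven_five_of_residuesZ5 h20
  intro N _ G hcell hd hk hfm hfb hH
  obtain ⟨-, hfat1⟩ := hH
  have hs := hcell.1
  have hl := hcell.2.1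
  have hG := hcell.2.2.2
  by_cases hnear : ∃ B ∈ thinMembers N 5 G, (G \ clF N B).card = 3
  · rcases Nat.lt_or_ge G.card 11 with hlt | hge
    · exact localShadowHall_two_one_of_not_near_fat hG hd hk hs hl hfat1 (Or.inr (Or.inr (by omega)))
    · rcases Nat.lt_or_ge G.card 17 with h16 | h17
      · rcases Nat.lt_or_ge (fatClosures N 5 G 2).card 1 with h0 | h1
        · have hnf : fatClosures N 5 G 2 = ∅ := Finset.card_eq_zero.1 (by omega)
          exact h21 N G hcell hd hk hfm hfb hnear hnf hge (by omega)
        · obtain ⟨B₀, hB₀, hm₀⟩ := exists_fat_member_of_card_eq_one hG hd (by omega)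
          exact localShadowHall_fat hG hd hk hs hl hfat1 hB₀ hm₀
      · exact localShadowHall_two_one_of_not_near_fat hG hd hk hs hl hfat1 (Or.inr (Or.inl h17))
  · apply localShadowHall_two_one_of_not_near_fat hG hd hk hs hl hfat1
    left
    intro B hB h3
    exact hnear ⟨B, hB, h3⟩

end SevenFiveZ6

end PercRepro.Shadow
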